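import Mathlib.Analysis.InnerProductSpace.Basic
import Mathlib.Analysis.SpecialFunctions.Pow.Real
import Mathlib.Analysis.SpecialFunctions.Log.Basic
import Mathlib.LinearAlgebra.Matrix.Determinant.Basic
import Mathlib.LinearAlgebra.FiniteDimensional.Basic
import Mathlib.Data.Nat.Factorial.Basic
import HarnessLib

/-!
# Dimock, *Ultraviolet stability for QED in d = 3*, §4.2.1 LEMMA 22 (467)–(470): «for `C_K(0) = D_K(0)^{−1}`,
# `|det C_K(0)| ≤ exp((Mr_K)⁴)`» — with its printed proof: the inverse formula (468)
# `C_K(0) = b_K^{−1} + Q_K(0)(D_0 + m̄_K)^{−1}Q_K^T(0)` (a Woodbury identity), the coercivity bound (469)–(470)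
# «`γ·∇` is skew adjoint … `‖(D_0 + m̄_K)^{−1}f‖ ≤ 2η^{−1}m̄_K^{−1}‖f‖`», and «a crude bound on `det C_K(0)` expanding it as
# a sum of permutations» — PROVED as operator ∕ matrix algebra, every «bounded», «sufficiently large» an explicit number

statement-level skeleton of published theorems with citation tags; proofs where landed; nothing here is a claim about the Yang–Mills mass gap

**Citation header (reproduction of PUBLISHED work).** J. Dimock, *Ultraviolet stability for QED in d = 3*, Ann. Henri
Poincaré **23** (2022) 2113–2205 (= arXiv:2009.01156v2) [Dimock2022UVStabilityQED3], §4.2.1 «fermion integral»,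
LEMMA 22 with its proof, p.63 L52–82 of the held arXiv text layer `paper:arxiv-2009.01156` (`p.NN Lnn` = PDF page ∕
text-layer line).  Writer seat p11 (literature-prover-lit-balaban-p11-g25-0), YM LIT SWEEP item (c) D8 (row C08 «WHERE»;
zero weight for the YM-INPRINT tokens).  Mathlib only (inner product spaces, `Matrix.det_apply'`, `Nat.factorial_le_pow`,
`Real.exp`∕`Real.log`).

**The printed text (verbatim, text layer).**  p.63 L52–82: *"Lemma 22. For `C_K(0) = D_K(0)^{−1}` satisfies
`|det C_K(0)| ≤ exp((Mr_K)⁴)` (467)  Proof. `D_K(0) = b_K − b_K²Q_k(0)S_K(0)Q^T_K(0)` is an operator on `T⁰_{N−K}` with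
`L^{N−K} = Mr_K` sites in each direction. The inverse `C_K(0) = D_K(0)^{−1}` is given by `C_K(0) = b_K^{−1} +
Q_K(0)(D_0 + m̄_K)^{−1}Q^T_K(0)` (468) This can be verified directly, or it is identity in Appendix B in [30] in the
special case `b = 0, y = 0`. The propagator `(D_0 + m̄_K)^{−1}` has no projection operator as did `S_K(0) = (D_0 + m̄_K +
b_KP_K(0))^{−1}`. But now we do not need it since we have `m̄_K = L^{−2(N−K)}m̄` which is positive and bounded below
independent of `N` by lemma 17. We note that since `D_0 = γ·∇ − ½ηΔ`, and since `γ·∇` is skew adjoint we have with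
`η = L^{−(N−K)}` and `L²` norms `|(f,(D_0 + m̄_K)f)| ≥ |Re(f,(D_0 + m̄_K)f)| = ½η(f,(−Δ + m̄_K)f) ≥ ½ηm̄_K‖f‖²` (469) Hence
`‖(D_0 + m̄_K)f‖ ≥ ½ηm̄_K‖f‖` and so `‖(D_0 + m̄_K)^{−1}f‖ ≤ 2η^{−1}m̄_K^{−1}‖f‖ = 2L^{3(N−K)}m̄^{−1}‖f‖` (470) … Since
`b_K^{−1}` and `Q_K(0)` are bounded we have `‖C_K(0)‖ ≤ CL^{3(N−K)} = C(Mr_K)³`. Hence every matrix element satisfies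
`|C_K(0,x,y)| ≤ C(Mr_K)³. We take a crude bound on `det C_K(0)` expanding it as a sum of permutations. There are
`((Mr_K)³)! ≤ exp(½(Mr_K)⁴)` permutations with the contribution of each permutation bounded by `[C(Mr_K)³]^{(Mr_K)³}`
which is less than `exp(½(Mr_K)⁴)`. Altogether we get the stated bound `exp((Mr_K)⁴)`."*

**What is formalized (kernel-checked, zero `sorry`, no named facts).**  The three steps of the printed proof, each in
the generality in which it is an identity ∕ inequality of linear algebra:
* §1 **(468), the inverse formula** — `eq468_mul_eq_one`: over any field, for a scalar `b ≠ 0`, any matrices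
  `Q` (coarse × fine), `Qt` (fine × coarse — the paper's `Q^T`; no transposition property is used), an invertible `T`
  (`= D_0 + m̄_K`) with inverse `G` and `S` with `S(T + bQtQ) = 1` (`= S_K(0) = (D_0 + m̄_K + b_KP_K(0))^{−1}`,
  `P_K = Q^TQ`): `(b − b²QSQt)(b^{−1} + QGQt) = 1` — *"This can be verified directly"* (the Woodbury computation:
  `bSQtQG = G − S`).
* §2 **(469)–(470), coercivity ⟹ invertibility with the inverse bound** — on a finite-dimensional inner product space
  over `𝕜 = ℝ` or `ℂ`: `norm_le_of_coercive` (`μ‖f‖² ≤ Re⟪f,Tf⟫ ⟹ μ‖f‖ ≤ ‖Tf‖`, Cauchy–Schwarz: the printed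
  `|(f,Tf)| ≥ |Re(f,Tf)| ≥ μ‖f‖²` «Hence `‖Tf‖ ≥ μ‖f‖`»), `re_inner_skew_eq_zero` («since `γ·∇` is skew adjoint»:
  `⟪Af,g⟫ = −⟪f,Ag⟫ ⟹ Re⟪f,Af⟫ = 0`), `coercive_of_skew_add` (`Re⟪f,(A + P)f⟫ = Re⟪f,Pf⟫ ≥ μ‖f‖²` for `A` skew and `P`
  coercive — the printed `D_0 + m̄_K = γ·∇ + (−½ηΔ + m̄_K)`), and **`exists_inverse_of_coercive`** = (470): such a `T` is
  invertible and `‖T^{−1}g‖ ≤ μ^{−1}‖g‖` (injective by the lower bound, bijective by finite dimension); then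
  `norm_apply_le_of_eq468` («since `b_K^{−1}` and `Q_K(0)` are bounded, `‖C_K(0)‖ ≤ C(Mr_K)³`»: `‖(b′ + QGQt)v‖ ≤
  (|b′| + qκq′)‖v‖`) and `norm_inner_apply_le` («every matrix element satisfies `|C_K(0,x,y)| ≤ C(Mr_K)³`»: matrix
  elements between unit vectors are bounded by the operator bound).
* §3 **(467), the «crude bound … as a sum of permutations»** — `norm_det_le_factorial_mul_pow` (`‖det C‖ ≤ n!·aⁿ` when
  every entry has norm `≤ a`, from `Matrix.det_apply'`), `factorial_mul_pow_le_exp` (`n!·aⁿ ≤ nⁿaⁿ = exp(n·log(na)) ≤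
  exp(X)` whenever `n·log(na) ≤ X`), **`lemma22_det_bound`**: for an `n × n` complex (or real) matrix with
  `|C(x,y)| ≤ c·m³` for all entries (the printed `|C_K(0,x,y)| ≤ C(Mr_K)³`, `m = Mr_K`) and `n·log(n·cm³) ≤ m⁴`,
  `|det C| ≤ exp(m⁴)` — (467); and `largeness_lemma22` — the implicit «for `Mr_K` large» made explicit: with `n ≤ sm³`
  sites × components, the condition `n·log(n·cm³) ≤ m⁴` holds as soon as `m ≥ 576s²` and `m ≥ 2s·log(sc)` (and `sc ≥ 1`).

**Readings ∕ located items (declared).**  (i) The printed chain `((Mr_K)³)! ≤ exp(½(Mr_K)⁴)`, `[C(Mr_K)³]^{(Mr_K)³} ≤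
exp(½(Mr_K)⁴)` holds for `Mr_K` LARGE (depending on the generic constant `C`, which the paper lets absorb `m̄^{−1}`,
p.63 L75–77); the formalization carries the largeness as the explicit hypothesis `n·log(n·a) ≤ m⁴` and discharges it
for `m` beyond an explicit threshold (`largeness_lemma22`).  (ii) The dimension `n` of `C_K(0)` is the number of sites
`(Mr_K)³` times the number of spinor components; the text counts `(Mr_K)³` — absorbed in `s`.  (iii) (469) is used in the
form `Re⟪f,Tf⟫ ≥ μ‖f‖²` with `μ` abstract (the printed `μ = ½ηm̄_K`); the decomposition `D_0 = γ·∇ − ½ηΔ` with `γ·∇`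
skew-adjoint and `−Δ ≥ 0` enters only through `coercive_of_skew_add`.  (iv) The chain (468) + (470) ⟹ `‖C_K(0)‖ ≤ …`
⟹ entry bound is proved for abstract operators and matrix elements `⟪e_x, Ce_y⟫` in an orthonormal basis
(`norm_apply_le_of_eq468`, `norm_inner_apply_le`); `lemma22_det_bound` then takes the entry bound of the MATRIX as its
hypothesis (the identification of the lattice operators with their matrices in the site ∕ spinor basis is not set up).

**Honest scope.**  The lattice operators `D_0 = γ·∇ − ½ηΔ`, `Q_K(0)`, `S_K(0)`, `D_K(0)` of the model are not
constructed here; the file proves the algebra and the analysis of the printed proof for abstract operators ∕ matrices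
with the printed properties as hypotheses (skew part, coercive part, the defining relations of `G`, `S`, the entry
bound).  Nothing about `m̄ ≠ 0` beyond `μ > 0`.  No `d = 4` statement; nothing about Bałaban's papers.
-/

noncomputable section

namespace Literature.MathematicalPhysics.QuantumFieldTheory.Dimock2011to13

namespace QED3FinalDeterminant

open Finset Real

/-! ## §1 (468): the inverse formula `C_K(0) = b^{−1} + Q(D_0 + m̄)^{−1}Q^T` — «This can be verified directly» -/

section Woodbury

variable {R : Type*} [Field R] {m n : Type*} [Fintype m] [Fintype n] [DecidableEq m] [DecidableEq n]

/-- **(468) verified directly**: with `T = D_0 + m̄_K` invertible (`TG = 1`), `S = S_K(0)` the inverse of `T + bQ^TQ`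
(`S(T + bQtQ) = 1`) and `b ≠ 0`, the operator `D_K(0) = b − b²QSQ^T` has the right inverse `b^{−1} + QGQ^T`:
`(b − b²QSQt)(b^{−1} + QGQt) = 1` (the Woodbury computation `bSQtQG = G − S`).  `Q`, `Qt` are arbitrary rectangular
matrices (no transposition property is used). [cite: Dimock2022UVStabilityQED3, §4.2.1 Lemma 22 proof (468) p.63 L55–60] -/
theorem eq468_mul_eq_one {b : R} (hb : b ≠ 0) (Q : Matrix m n R) (Qt : Matrix n m R) (T G S : Matrix n n R)
    (hTG : T * G = 1) (hS : S * (T + b • (Qt * Q)) = 1) :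
    (b • (1 : Matrix m m R) - b ^ 2 • (Q * S * Qt)) * (b⁻¹ • (1 : Matrix m m R) + Q * G * Qt) = 1 := by
  -- the Woodbury step: `b • (S·QtQ·G) = G − S`
  have hkey : b • (S * (Qt * Q) * G) = G - S := by
    have h1 : S * (T + b • (Qt * Q)) * G = G := by rw [hS, Matrix.one_mul]
    rw [Matrix.mul_add, Matrix.add_mul, Matrix.mul_assoc S T G, hTG, Matrix.mul_one, Matrix.mul_smul,
      Matrix.smul_mul] at h1
    rw [eq_sub_iff_add_eq']
    exact h1
  have hkey' : b • (Q * (S * (Qt * Q) * G) * Qt) = Q * G * Qt - Q * S * Qt := by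
    rw [← Matrix.smul_mul, ← Matrix.mul_smul, hkey, Matrix.mul_sub, Matrix.sub_mul]
  have hAB : (b ^ 2 • (Q * S * Qt)) * (Q * G * Qt) = b • (Q * G * Qt) - b • (Q * S * Qt) := by
    have e1 : Q * S * Qt * (Q * G * Qt) = Q * (S * (Qt * Q) * G) * Qt := by
      simp only [Matrix.mul_assoc]
    rw [Matrix.smul_mul, e1, pow_two, mul_smul, hkey', smul_sub]
  -- expand the product
  rw [Matrix.sub_mul, Matrix.mul_add, Matrix.mul_add, hAB, Matrix.smul_mul, Matrix.one_mul, smul_smul,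
    mul_inv_cancel₀ hb, one_smul, Matrix.smul_mul, Matrix.one_mul, Matrix.mul_smul, Matrix.mul_one, smul_smul,
    show b⁻¹ * b ^ 2 = b by rw [pow_two, ← mul_assoc, inv_mul_cancel₀ hb, one_mul]]
  abel

end Woodbury

/-! ## §2 (469)–(470): skew part + coercive part ⟹ invertible with `‖T^{−1}‖ ≤ μ^{−1}` -/

section Coercive

variable {𝕜 : Type*} [RCLike 𝕜] {V : Type*} [NormedAddCommGroup V] [InnerProductSpace 𝕜 V]

open RCLike

/-- **(469) ⟹ «Hence `‖(D_0 + m̄_K)f‖ ≥ ½ηm̄_K‖f‖`»**: if `μ‖f‖² ≤ Re⟪f,Tf⟫` for all `f` (`μ > 0`), then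
`μ‖f‖ ≤ ‖Tf‖` — Cauchy–Schwarz `Re⟪f,Tf⟫ ≤ |⟪f,Tf⟫| ≤ ‖f‖‖Tf‖`.
[cite: Dimock2022UVStabilityQED3, §4.2.1 Lemma 22 proof (469)–(470) p.63 L64–72] -/
theorem norm_le_of_coercive (T : V →ₗ[𝕜] V) {μ : ℝ}
    (hco : ∀ f, μ * ‖f‖ ^ 2 ≤ re (inner 𝕜 f (T f))) (f : V) : μ * ‖f‖ ≤ ‖T f‖ := by
  by_cases hf : f = 0
  · rw [hf, norm_zero, mul_zero]
    exact norm_nonneg _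
  have hpos : 0 < ‖f‖ := norm_pos_iff.2 hf
  have h1 : re (inner 𝕜 f (T f)) ≤ ‖f‖ * ‖T f‖ := (re_le_norm _).trans (norm_inner_le_norm f (T f))
  have h2 : μ * ‖f‖ * ‖f‖ ≤ ‖T f‖ * ‖f‖ := by
    have h := (hco f).trans h1
    rw [pow_two, ← mul_assoc] at h
    linarith
  exact le_of_mul_le_mul_right h2 hpos

/-- **«since `γ·∇` is skew adjoint»**: a skew-adjoint operator (`⟪Af,g⟫ = −⟪f,Ag⟫`) has `Re⟪f,Af⟫ = 0`.
[cite: Dimock2022UVStabilityQED3, §4.2.1 Lemma 22 proof (469) p.63 L64–68] -/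
theorem re_inner_skew_eq_zero (A : V →ₗ[𝕜] V) (hskew : ∀ f g, (inner 𝕜 (A f) g) = -(inner 𝕜 f (A g))) (f : V) :
    re (inner 𝕜 f (A f)) = 0 := by
  have h := hskew f f
  rw [← inner_conj_symm (A f) f] at h
  -- `⟪Af,f⟫ = −conj⟪Af,f⟫` ⟹ real part zero
  have h2 := congrArg re h
  rw [map_neg, conj_re] at h2
  linarith

/-- **(469)**: for `T = A + P` with `A` skew adjoint (`γ·∇`) and `P` coercive (`−½ηΔ + m̄_K ≥ m̄_K > 0`),
`Re⟪f,Tf⟫ = Re⟪f,Pf⟫ ≥ μ‖f‖²` — «`|(f,(D_0 + m̄_K)f)| ≥ |Re(f,(D_0 + m̄_K)f)| = ½η(f,(−Δ + m̄_K)f) ≥ ½ηm̄_K‖f‖²`».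
[cite: Dimock2022UVStabilityQED3, §4.2.1 Lemma 22 proof (469) p.63 L64–68] -/
theorem coercive_of_skew_add (A P : V →ₗ[𝕜] V) (hskew : ∀ f g, (inner 𝕜 (A f) g) = -(inner 𝕜 f (A g))) {μ : ℝ}
    (hP : ∀ f, μ * ‖f‖ ^ 2 ≤ re (inner 𝕜 f (P f))) (f : V) : μ * ‖f‖ ^ 2 ≤ re (inner 𝕜 f ((A + P) f)) := by
  rw [LinearMap.add_apply, inner_add_right, map_add, re_inner_skew_eq_zero A hskew f, zero_add]
  exact hP f

variable [FiniteDimensional 𝕜 V]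

/-- **(470): coercivity ⟹ invertibility with the inverse bound** — «so `‖(D_0 + m̄_K)^{−1}f‖ ≤ 2η^{−1}m̄_K^{−1}‖f‖`»: on a
finite-dimensional inner product space, if `μ‖f‖² ≤ Re⟪f,Tf⟫` for all `f` with `μ > 0`, then `T` has a two-sided inverse
`S` with `‖Sg‖ ≤ μ^{−1}‖g‖` (injective by `norm_le_of_coercive`, surjective by finite dimension).
[cite: Dimock2022UVStabilityQED3, §4.2.1 Lemma 22 proof (470) p.63 L69–72] -/
theorem exists_inverse_of_coercive (T : V →ₗ[𝕜] V) {μ : ℝ} (hμ : 0 < μ)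
    (hco : ∀ f, μ * ‖f‖ ^ 2 ≤ re (inner 𝕜 f (T f))) :
    ∃ S : V →ₗ[𝕜] V, S ∘ₗ T = LinearMap.id ∧ T ∘ₗ S = LinearMap.id ∧ ∀ g, ‖S g‖ ≤ μ⁻¹ * ‖g‖ := by
  have hinj : Function.Injective T := by
    intro f f' h
    have h1 := norm_le_of_coercive T hco (f - f')
    rw [map_sub, h, sub_self, norm_zero] at h1
    have h2 : ‖f - f'‖ ≤ 0 := by
      by_contra hlt
      rw [not_le] at hlt
      have := mul_pos hμ hlt
      linarith
    exact sub_eq_zero.1 (norm_le_zero_iff.1 h2)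
  have hbij : Function.Bijective T := ⟨hinj, LinearMap.injective_iff_surjective.1 hinj⟩
  set e : V ≃ₗ[𝕜] V := LinearEquiv.ofBijective T hbij with he
  have heT : ∀ f, e f = T f := fun f => rfl
  refine ⟨e.symm.toLinearMap, ?_, ?_, fun g => ?_⟩
  · ext f
    show e.symm (T f) = f
    rw [← heT, e.symm_apply_apply]
  · ext g
    show T (e.symm g) = g
    rw [← heT, e.apply_symm_apply]
  · have h := norm_le_of_coercive T hco (e.symm g)
    rw [← heT, e.apply_symm_apply] at h
    show ‖e.symm g‖ ≤ μ⁻¹ * ‖g‖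
    rw [inv_mul_eq_div]
    exact (le_div_iff₀' hμ).2 h

omit [FiniteDimensional 𝕜 V] in
/-- **«Since `b_K^{−1}` and `Q_K(0)` are bounded we have `‖C_K(0)‖ ≤ CL^{3(N−K)}`»**: for `C = b′·1 + Q∘G∘Qt` with
`‖Gw‖ ≤ κ‖w‖` ((470)), `‖Qw‖ ≤ q‖w‖`, `‖Qtv‖ ≤ q′‖v‖`: `‖Cv‖ ≤ (‖b′‖ + qκq′)‖v‖`.
[cite: Dimock2022UVStabilityQED3, §4.2.1 Lemma 22 proof p.63 L76–77] -/
theorem norm_apply_le_of_eq468 {W : Type*} [NormedAddCommGroup W] [InnerProductSpace 𝕜 W]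
    (b' : 𝕜) (Q : W →ₗ[𝕜] V) (G : W →ₗ[𝕜] W) (Qt : V →ₗ[𝕜] W) {q κ q' : ℝ} (hq : 0 ≤ q) (hκ : 0 ≤ κ)
    (hQ : ∀ w, ‖Q w‖ ≤ q * ‖w‖) (hG : ∀ w, ‖G w‖ ≤ κ * ‖w‖) (hQt : ∀ v, ‖Qt v‖ ≤ q' * ‖v‖) (v : V) :
    ‖(b' • (LinearMap.id : V →ₗ[𝕜] V) + Q ∘ₗ (G ∘ₗ Qt)) v‖ ≤ (‖b'‖ + q * κ * q') * ‖v‖ := by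
  rw [LinearMap.add_apply, LinearMap.smul_apply, LinearMap.id_apply, LinearMap.comp_apply, LinearMap.comp_apply]
  refine (norm_add_le _ _).trans ?_
  rw [norm_smul, add_mul]
  refine add_le_add le_rfl ?_
  calc ‖Q (G (Qt v))‖ ≤ q * ‖G (Qt v)‖ := hQ _
    _ ≤ q * (κ * ‖Qt v‖) := mul_le_mul_of_nonneg_left (hG _) hq
    _ ≤ q * (κ * (q' * ‖v‖)) := mul_le_mul_of_nonneg_left (mul_le_mul_of_nonneg_left (hQt v) hκ) hq
    _ = q * κ * q' * ‖v‖ := by ring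

omit [FiniteDimensional 𝕜 V] in
/-- **«Hence every matrix element satisfies `|C_K(0,x,y)| ≤ C(Mr_K)³`»**: a matrix element `⟪u, Cv⟫` between unit (or
shorter) vectors is bounded by the operator bound: `‖Cg‖ ≤ K‖g‖ ⟹ |⟪u,Cv⟫| ≤ K`.
[cite: Dimock2022UVStabilityQED3, §4.2.1 Lemma 22 proof p.63 L77–78] -/
theorem norm_inner_apply_le (C : V →ₗ[𝕜] V) {K : ℝ} (hK : 0 ≤ K) (hC : ∀ g, ‖C g‖ ≤ K * ‖g‖) {u v : V}
    (hu : ‖u‖ ≤ 1) (hv : ‖v‖ ≤ 1) : ‖(inner 𝕜 u (C v))‖ ≤ K := by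
  calc ‖(inner 𝕜 u (C v))‖ ≤ ‖u‖ * ‖C v‖ := norm_inner_le_norm u (C v)
    _ ≤ 1 * (K * ‖v‖) := mul_le_mul hu (hC v) (norm_nonneg _) zero_le_one
    _ ≤ 1 * (K * 1) := by
        refine mul_le_mul_of_nonneg_left (mul_le_mul_of_nonneg_left hv hK) zero_le_one
    _ = K := by ring

end Coercive

/-! ## §3 (467): the «crude bound on `det C_K(0)` expanding it as a sum of permutations» -/

section Det

variable {𝕜 : Type*} [NormedField 𝕜] {n : Type*} [Fintype n] [DecidableEq n]

/-- **«a sum of permutations … the contribution of each permutation bounded by `[C(Mr_K)³]^{(Mr_K)³}`»**: if every entry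
of an `n × n` matrix has norm `≤ a`, then `‖det C‖ ≤ n!·aⁿ`. [cite: Dimock2022UVStabilityQED3, §4.2.1 Lemma 22 proof p.63 L78–82] -/
theorem norm_det_le_factorial_mul_pow {C : Matrix n n 𝕜} {a : ℝ} (ha : ∀ i j, ‖C i j‖ ≤ a) :
    ‖C.det‖ ≤ (Fintype.card n).factorial * a ^ Fintype.card n := by
  rw [Matrix.det_apply']
  calc ‖∑ σ : Equiv.Perm n, ((Equiv.Perm.sign σ : ℤ) : 𝕜) * ∏ i, C (σ i) i‖
      ≤ ∑ σ : Equiv.Perm n, ‖((Equiv.Perm.sign σ : ℤ) : 𝕜) * ∏ i, C (σ i) i‖ := norm_sum_le _ _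
    _ ≤ ∑ _σ : Equiv.Perm n, a ^ Fintype.card n := sum_le_sum fun σ _ => by
        rw [norm_mul]
        have hε : ‖((Equiv.Perm.sign σ : ℤ) : 𝕜)‖ = 1 := by
          rcases Int.units_eq_one_or (Equiv.Perm.sign σ) with h | h <;> simp [h]
        rw [hε, one_mul, norm_prod]
        calc ∏ i, ‖C (σ i) i‖ ≤ ∏ _i : n, a :=
              prod_le_prod (fun i _ => norm_nonneg _) (fun i _ => ha _ _)
          _ = a ^ Fintype.card n := by rw [prod_const, card_univ]
    _ = (Fintype.card (Equiv.Perm n) : ℝ) * a ^ Fintype.card n := by rw [sum_const, card_univ, nsmul_eq_mul]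
    _ = (Fintype.card n).factorial * a ^ Fintype.card n := by rw [Fintype.card_perm]

/-- **«`((Mr_K)³)! ≤ exp(½(Mr_K)⁴)` … `[C(Mr_K)³]^{(Mr_K)³}` less than `exp(½(Mr_K)⁴)`», quantified**: `N!·a^N ≤ N^N·a^N =
exp(N·log(Na)) ≤ exp(X)` whenever `N·log(N·a) ≤ X` (`a > 0`). [cite: Dimock2022UVStabilityQED3, §4.2.1 Lemma 22 proof p.63 L78–82] -/
theorem factorial_mul_pow_le_exp {N : ℕ} {a X : ℝ} (ha : 0 < a) (h : (N : ℝ) * Real.log (N * a) ≤ X) :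
    (N.factorial : ℝ) * a ^ N ≤ Real.exp X := by
  rcases Nat.eq_zero_or_pos N with rfl | hN
  · simp only [Nat.factorial_zero, Nat.cast_one, pow_zero, mul_one, Nat.cast_zero, zero_mul] at h ⊢
    exact Real.one_le_exp h
  have hNr : (0 : ℝ) < N := by exact_mod_cast hN
  have hNa : 0 < (N : ℝ) * a := mul_pos hNr ha
  calc (N.factorial : ℝ) * a ^ N ≤ ((N : ℝ) ^ N) * a ^ N := by
        refine mul_le_mul_of_nonneg_right ?_ (pow_nonneg ha.le N)
        exact_mod_cast Nat.factorial_le_pow N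
    _ = ((N : ℝ) * a) ^ N := by rw [mul_pow]
    _ = Real.exp ((N : ℝ) * Real.log (N * a)) := by
        rw [← Real.rpow_natCast, Real.rpow_def_of_pos hNa, mul_comm]
    _ ≤ Real.exp X := Real.exp_le_exp.2 h

/-- **LEMMA 22, (467)**: for a square matrix `C` (`= C_K(0)`, complex or real entries) whose entries satisfy the
printed bound `|C(x,y)| ≤ c·m³` (`m = Mr_K`, «`|C_K(0,x,y)| ≤ C(Mr_K)³`») and whose size `n` obeys
`n·log(n·cm³) ≤ m⁴` (the largeness the text leaves implicit, see `largeness_lemma22`): `|det C| ≤ exp(m⁴)` — by the sum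
over permutations (`norm_det_le_factorial_mul_pow`, `factorial_mul_pow_le_exp`).
[cite: Dimock2022UVStabilityQED3, §4.2.1 Lemma 22 (467) p.63 L52–53, proof L78–82] -/
theorem lemma22_det_bound {C : Matrix n n 𝕜} {c : ℝ} {m : ℕ} (hc : 0 < c) (hm : 0 < m)
    (hent : ∀ i j, ‖C i j‖ ≤ c * (m : ℝ) ^ 3)
    (hlarge : (Fintype.card n : ℝ) * Real.log (Fintype.card n * (c * (m : ℝ) ^ 3)) ≤ (m : ℝ) ^ 4) :
    ‖C.det‖ ≤ Real.exp ((m : ℝ) ^ 4) := by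
  have hmr : (0 : ℝ) < m := by exact_mod_cast hm
  exact (norm_det_le_factorial_mul_pow hent).trans (factorial_mul_pow_le_exp (by positivity) hlarge)

/-- **the implicit «for `Mr_K` large» made explicit**: if the matrix size is `n ≤ s·m³` (sites × components, `s ≥ 1`),
`sc ≥ 1`, `m ≥ 576s²` and `m ≥ 2s·log(sc)`, then `n·log(n·cm³) ≤ m⁴` — so (467) holds for every `m = Mr_K` beyond an
explicit threshold (`log m ≤ 2√m`, `12s√m ≤ m∕2`). [cite: Dimock2022UVStabilityQED3, §4.2.1 Lemma 22 proof p.63 L78–82] -/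
theorem largeness_lemma22 {n s m : ℕ} {c : ℝ} (hs : 1 ≤ s) (hsc : 1 ≤ (s : ℝ) * c) (hn : n ≤ s * m ^ 3)
    (hm1 : 576 * s ^ 2 ≤ m) (hm2 : 2 * (s : ℝ) * Real.log (s * c) ≤ m) :
    (n : ℝ) * Real.log (n * (c * (m : ℝ) ^ 3)) ≤ (m : ℝ) ^ 4 := by
  have hsr : (1 : ℝ) ≤ s := by exact_mod_cast hs
  have hs0 : (0 : ℝ) < s := by linarith
  have hc0 : 0 < c := by
    by_contra hle
    rw [not_lt] at hle
    have : (s : ℝ) * c ≤ 0 := mul_nonpos_of_nonneg_of_nonpos hs0.le hle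
    linarith
  have hm576 : (576 : ℝ) * (s : ℝ) ^ 2 ≤ m := by exact_mod_cast hm1
  have hm0 : (0 : ℝ) < m := by nlinarith
  have hm1' : (1 : ℝ) ≤ m := by nlinarith
  have hnr : (n : ℝ) ≤ s * (m : ℝ) ^ 3 := by exact_mod_cast hn
  -- the case `n = 0` is trivial
  rcases Nat.eq_zero_or_pos n with rfl | hnpos
  · rw [Nat.cast_zero, zero_mul]
    positivity
  have hn0 : (0 : ℝ) < n := by exact_mod_cast hnpos
  -- `log(n·cm³) ≤ log(sc·m⁶) = log(sc) + 6 log m`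
  have hlogm : 0 ≤ Real.log m := Real.log_nonneg hm1'
  have hlog1 : Real.log (n * (c * (m : ℝ) ^ 3)) ≤ Real.log (s * c) + 6 * Real.log m := by
    have hle : (n : ℝ) * (c * (m : ℝ) ^ 3) ≤ (s * c) * (m : ℝ) ^ 6 := by
      have := mul_le_mul_of_nonneg_right hnr (by positivity : 0 ≤ c * (m : ℝ) ^ 3)
      calc (n : ℝ) * (c * (m : ℝ) ^ 3) ≤ s * (m : ℝ) ^ 3 * (c * (m : ℝ) ^ 3) := this
        _ = (s * c) * (m : ℝ) ^ 6 := by ring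
    calc Real.log (n * (c * (m : ℝ) ^ 3)) ≤ Real.log ((s * c) * (m : ℝ) ^ 6) :=
          Real.log_le_log (by positivity) hle
      _ = Real.log (s * c) + 6 * Real.log m := by
          rw [Real.log_mul (by positivity) (by positivity), Real.log_pow]
          push_cast
          ring
  -- `log m ≤ 2√m` and `12 s √m ≤ m∕2`
  have hsq : Real.log m ≤ 2 * Real.sqrt m := by
    have h1 : Real.log (Real.sqrt m) ≤ Real.sqrt m - 1 := Real.log_le_sub_one_of_pos (Real.sqrt_pos.2 hm0)
    have h2 : Real.log m = 2 * Real.log (Real.sqrt m) := by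
      rw [Real.log_sqrt hm0.le]
      ring
    rw [h2]
    linarith [Real.sqrt_nonneg (m : ℝ)]
  have hsqrt_ge : 24 * (s : ℝ) ≤ Real.sqrt m := by
    have h := Real.sqrt_le_sqrt hm576
    rw [show (576 : ℝ) * (s : ℝ) ^ 2 = (24 * s) ^ 2 by ring, Real.sqrt_sq (by positivity)] at h
    exact h
  have hsqm : Real.sqrt m * Real.sqrt m = m := Real.mul_self_sqrt hm0.le
  have h6 : 6 * (s : ℝ) * Real.log m ≤ (m : ℝ) / 2 := by
    calc 6 * (s : ℝ) * Real.log m ≤ 6 * s * (2 * Real.sqrt m) := by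
          exact mul_le_mul_of_nonneg_left hsq (by positivity)
      _ = 12 * s * Real.sqrt m := by ring
      _ ≤ (Real.sqrt m / 2) * Real.sqrt m := by
          have : 12 * (s : ℝ) ≤ Real.sqrt m / 2 := by linarith
          exact mul_le_mul_of_nonneg_right this (Real.sqrt_nonneg _)
      _ = (m : ℝ) / 2 := by rw [div_mul_eq_mul_div, hsqm]
  -- assemble: `n·log(…) ≤ s m³ (log(sc) + 6 log m) ≤ s m³ · (m∕s) = m⁴`
  have hlogpos : 0 ≤ Real.log (s * c) := Real.log_nonneg hsc
  have hB : 0 ≤ Real.log (s * c) + 6 * Real.log m := by positivity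
  have hstep : (s : ℝ) * (Real.log (s * c) + 6 * Real.log m) ≤ m := by
    have : (s : ℝ) * Real.log (s * c) ≤ (m : ℝ) / 2 := by linarith
    nlinarith
  by_cases hneg : Real.log (n * (c * (m : ℝ) ^ 3)) ≤ 0
  · have : (n : ℝ) * Real.log (n * (c * (m : ℝ) ^ 3)) ≤ 0 := mul_nonpos_of_nonneg_of_nonpos hn0.le hneg
    linarith [pow_pos hm0 4]
  rw [not_le] at hneg
  calc (n : ℝ) * Real.log (n * (c * (m : ℝ) ^ 3))
      ≤ (s * (m : ℝ) ^ 3) * (Real.log (s * c) + 6 * Real.log m) :=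
        mul_le_mul hnr hlog1 hneg.le (by positivity)
    _ = (m : ℝ) ^ 3 * ((s : ℝ) * (Real.log (s * c) + 6 * Real.log m)) := by ring
    _ ≤ (m : ℝ) ^ 3 * m := mul_le_mul_of_nonneg_left hstep (by positivity)
    _ = (m : ℝ) ^ 4 := by ring

end Det

end QED3FinalDeterminant

end Literature.MathematicalPhysics.QuantumFieldTheory.Dimock2011to13
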